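import Summits.AtomisticToContinuum.FouriersLaw.Theses.LocalOhmBV
import Summits.AtomisticToContinuum.FouriersLaw.Theses.TransferKernelPositivity
import Summits.AtomisticToContinuum.FouriersLaw.Theorems.PuiseuxTransferLedgerTwoModeBulkReduction
import Summits.AtomisticToContinuum.FouriersLaw.Theorems.PhononMeanFreePathIncoherentBoundedCurrentKubo
import Summits.AtomisticToContinuum.FouriersLaw.Theorems.PhononMeanFreePathIncoherentBoundedContactBound
import Summits.AtomisticToContinuum.FouriersLaw.Theorems.TransferKernelPositivityContactIdentity

/-!
# Thermal passivity AT THE CONTACT SITES, uniformly in `N`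
(`--supports` crux `LocalOhmBV.BVProfile`, item stmt-AtomisticToContinuum-12012, stub `stub_profileBound` of line
`registered`)

The stub `stub_profileBound` asks for an `N`-UNIFORM sup bound `|t| ≤ B` on every limit `t` of the kinetic-temperature
response difference quotient `δ ↦ (μ_{N,T+δ/2,T−δ/2}(p_i²) − μ_{N,T,T}(p_i²))/δ` at EVERY site `i` of the pinned
anharmonic chain `pinnedChain ω₂ lam β γ` (all `> 0`) between Langevin baths, under weak-NESS uniqueness and along any
steady-state family. For BULK sites this is the open passivity problem (BonettoLebowitzLukkarinenOlla2009). This file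
proves the sharp bound `|t| ≤ 1/2` at the two CONTACT sites `i = 0` and `i = N − 1`, for every `N`, unconditionally
(`profileBound_contact`) — the genuinely `N`-uniform part of the stub that the tree's material reaches:

* at the far contact `i = N − 1` of the `N = M + 1`-site chain the limit IS
  `u_M(M) = (γ/T²)∫₀^∞ C_M − 1/2` (`TwoModeBulk.Sketch.tendsto_profileValue` + uniqueness of limits along `𝓝[≠] 0`),
  `C_M(t) = Cov_{Gibbs_T}(p_0², K_t p_M²)` the cross Kubo kernel, and the LANDED `N`-uniform conductance bounds
  `0 ≤ (γ²/T²)∫₀^∞ C_M ≤ γ/2` (`IncoherentBounded.conductance_nonneg`: Green–Kubo positivity of the total current;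
  `IncoherentBounded.conductance_le_half`: Green–Kubo positivity of `p_0² − p_M²` + the sum rule) give
  `u_M(M) ∈ [−1/2, 0]`;
* at the near contact `i = 0` (`N ≥ 2`) the landed contact identity
  `d = γ(N−1)(1/2 − θ₀) = γ(N−1)(θ₁ + 1/2)` (`transferKernelPositivity_contactIdentity_proof`, with the response
  coefficient `d` from `FiniteResponseOfUnique_holds`) gives `θ₀ = −θ₁`, so `|θ₀| = |θ₁| ≤ 1/2`; `N = 1`: site `0` is
  the far contact.

Rider (`stub_profileBound_iff_cutBondBound`): the stub is EQUIVALENT to the pure equilibrium statement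
`∃ B ∀ N ∀ i : Fin (N+1), |u_N(i)| ≤ B` with `u_N(i) = (γ/T²)∫₀^∞ Cov_{Gibbs_T}(p_0², K_t p_i²) − 1/2` (lossless
reduction: (→) along a chosen steady family at `NessUnique_holds`; (←) uniqueness of limits), so what remains of the
stub is an `N`-uniform bound on the BULK entries of one explicit equilibrium space–time covariance.

No definitions, no named facts, no sorry; standard axioms.
-/

noncomputable section

open MeasureTheory Filter Topology Set

namespace Summit.AtomisticToContinuum.FouriersLaw.Theorems

open Literature.MathematicalPhysics.KineticTheory.HeatConduction
open Summit.AtomisticToContinuum.FouriersLaw.Theorems.BoundaryKubo.Negative.LoadBearing (UniqueSteady SteadyFamily)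
open Summit.AtomisticToContinuum.FouriersLaw.Theorems.TwoModeBulk.Sketch (tendsto_profileValue exists_steadyFamily)
open Summit.AtomisticToContinuum.FouriersLaw.Theorems.IncoherentBounded (conductance_nonneg conductance_le_half)

/-- Elementary: if `0 ≤ γ²/T²·I ≤ γ/2` with `γ > 0` and `s = γ/T²·I − 1/2`, then `|s| ≤ 1/2`. [folklore] -/
private theorem abs_le_half_of_conductance_bounds {γ T I s : ℝ} (hγ : 0 < γ)
    (h0 : 0 ≤ γ ^ 2 / T ^ 2 * I) (h1 : γ ^ 2 / T ^ 2 * I ≤ γ / 2) (hs : s = γ / T ^ 2 * I - 1 / 2) :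
    |s| ≤ 1 / 2 := by
  have ha : γ ^ 2 / T ^ 2 * I = γ * (γ / T ^ 2 * I) := by ring
  rw [ha] at h0 h1
  have h0' : 0 ≤ γ / T ^ 2 * I := (mul_nonneg_iff_of_pos_left hγ).mp h0
  have h1' : γ / T ^ 2 * I ≤ 1 / 2 := le_of_mul_le_mul_left (by linarith) hγ
  rw [hs, abs_le]
  constructor <;> linarith

/-- Elementary: from `d = γc(1/2 − t) = γc(V + 1/2)` with `γc > 0` and `|V| ≤ 1/2`, `|t| ≤ 1/2`. [folklore] -/
private theorem abs_le_half_of_contactIdentity {γ c t V d : ℝ} (hc : 0 < γ * c)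
    (h1 : d = γ * c * (1 / 2 - t)) (h2 : d = γ * c * (V + 1 / 2)) (hb : |V| ≤ 1 / 2) : |t| ≤ 1 / 2 := by
  have h : 1 / 2 - t = V + 1 / 2 := mul_left_cancel₀ hc.ne' (h1.symm.trans h2)
  have ht : t = -V := by linarith
  rw [ht, abs_neg]
  exact hb

/-- **Thermal passivity at the contact sites, uniformly in `N`.** For `pinnedChain ω₂ lam β γ` (all `> 0`), under
weak-NESS uniqueness, along any steady-state family `μ` and for every `T > 0`: for every `N`, every CONTACT site
`i : Fin N` (`i.val = 0` or `i.val = N − 1`) and every limit `t` of the kinetic-temperature response difference quotient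
`δ ↦ (μ_{N,T+δ/2,T−δ/2}(p_i²) − μ_{N,T,T}(p_i²))/δ` along `𝓝[≠] 0`: `|t| ≤ 1/2`. Far contact: the limit is
`(γ/T²)∫₀^∞ C − 1/2` (`tendsto_profileValue`) and `0 ≤ (γ²/T²)∫₀^∞ C ≤ γ/2` (`conductance_nonneg`,
`conductance_le_half`); near contact (`N ≥ 2`): the contact identity `d = γ(N−1)(1/2 − θ₀) = γ(N−1)(θ₁ + 1/2)` makes the
two contact responses opposite. [cite: KunduDharNarayan2009, arXiv:0809.4543 p. 3] -/
theorem profileBound_contact :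
    ∀ ω₂ lam β γ : ℝ, 0 < ω₂ → 0 < lam → 0 < β → 0 < γ → (∀ (N : ℕ) (T_L T_R : ℝ), 0 < T_L → 0 < T_R → ∀ μ ν : MeasureTheory.Measure (Literature.MathematicalPhysics.KineticTheory.HeatConduction.PhaseSpace N), (Literature.MathematicalPhysics.KineticTheory.HeatConduction.pinnedChain ω₂ lam β γ).IsSteadyState N T_L T_R μ → (Literature.MathematicalPhysics.KineticTheory.HeatConduction.pinnedChain ω₂ lam β γ).IsSteadyState N T_L T_R ν → μ = ν) → ∀ μ : (N : ℕ) → ℝ → ℝ → MeasureTheory.Measure (Literature.MathematicalPhysics.KineticTheory.HeatConduction.PhaseSpace N), (∀ (N : ℕ) (T_L T_R : ℝ), 0 < T_L → 0 < T_R → (Literature.MathematicalPhysics.KineticTheory.HeatConduction.pinnedChain ω₂ lam β γ).IsSteadyState N T_L T_R (μ N T_L T_R)) → ∀ T : ℝ, 0 < T → ∀ (N : ℕ) (i : Fin N) (t : ℝ), (i.val = 0 ∨ i.val = N - 1) → Filter.Tendsto (fun δ : ℝ => ((∫ x, (x.2 i) ^ 2 ∂(μ N (T + δ / 2) (T - δ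 / 2))) - ∫ x, (x.2 i) ^ 2 ∂(μ N T T)) / δ) (nhdsWithin 0 {(0 : ℝ)}ᶜ) (nhds t) → |t| ≤ 1 / 2 := by
  intro ω₂ lam β γ hω hl hβ hγ huniq μ hμ T hT N i t hi ht
  have hU : UniqueSteady ω₂ lam β γ := huniq
  have hfam : SteadyFamily ω₂ lam β γ μ := hμ
  cases N with
  | zero => exact i.elim0
  | succ M =>
    -- the far contact `j.val = M` of the `(M+1)`-site chain: the limit is the cut-bond value, bounded by the
    -- `N`-uniform conductance bounds
    have hfar : ∀ j : Fin (M + 1), j.val = M → ∀ s : ℝ,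
        Tendsto (fun δ : ℝ => ((∫ x, (x.2 j) ^ 2 ∂(μ (M + 1) (T + δ / 2) (T - δ / 2))) -
          ∫ x, (x.2 j) ^ 2 ∂(μ (M + 1) T T)) / δ) (𝓝[≠] 0) (𝓝 s) → |s| ≤ 1 / 2 := by
      intro j hj s hs
      have hjl : j = Fin.last M := Fin.ext hj
      subst hjl
      have hlim := tendsto_profileValue hω hl hβ hγ hU hfam hT M (Fin.last M)
      exact abs_le_half_of_conductance_bounds hγ (conductance_nonneg hω hl.le hβ hγ hT M)
        (conductance_le_half hω hl.le hβ hγ hT M) (tendsto_nhds_unique hs hlim)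
    rcases hi with hi0 | hiM
    · -- the near contact `i.val = 0`
      rcases Nat.eq_zero_or_pos M with hM0 | hMpos
      · -- one site: the near contact is the far contact
        subst hM0
        exact hfar i hi0 t ht
      · -- `N = M + 1 ≥ 2`: contact identity
        obtain ⟨iv, hiv⟩ := i
        simp only at hi0
        subst hi0
        obtain ⟨d, hd⟩ :=
          Summit.AtomisticToContinuum.FouriersLaw.Theses.LocalOhmBV.FiniteResponseOfUnique_holds ω₂ lam β γ hω hl hβ
            hγ huniq μ hμ T hT (M + 1)
        have hV0 := tendsto_profileValue hω hl hβ hγ hU hfam hT M (⟨M + 1 - 1, by omega⟩ : Fin (M + 1))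
        obtain ⟨V, hV⟩ :
            ∃ V : ℝ, Tendsto (fun δ : ℝ => ((∫ x, (x.2 (⟨M + 1 - 1, by omega⟩ : Fin (M + 1))) ^ 2
                ∂(μ (M + 1) (T + δ / 2) (T - δ / 2))) -
              ∫ x, (x.2 (⟨M + 1 - 1, by omega⟩ : Fin (M + 1))) ^ 2 ∂(μ (M + 1) T T)) / δ) (𝓝[≠] 0) (𝓝 V) :=
          ⟨_, hV0⟩
        clear hV0
        have hVb : |V| ≤ 1 / 2 := hfar ⟨M + 1 - 1, by omega⟩ (by simp) V hV
        obtain ⟨h1, h2⟩ := transferKernelPositivity_contactIdentity_proof ω₂ lam β γ hω hl hβ hγ huniq μ hμ T hT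
          (M + 1) (by omega) t V d ht hV hd
        have hc : 0 < γ * (((M + 1 : ℕ) : ℝ) - 1) := by
          have : (1 : ℝ) ≤ M := by exact_mod_cast hMpos
          have : (0 : ℝ) < ((M + 1 : ℕ) : ℝ) - 1 := by push_cast; linarith
          positivity
        exact abs_le_half_of_contactIdentity hc h1 h2 hVb
    · -- the far contact `i.val = (M + 1) - 1 = M`
      exact hfar i (by omega) t ht

/-- **The stub `stub_profileBound` is EQUIVALENT to an `N`-uniform bound on ONE explicit equilibrium profile** (lossless
reduction, no NESS / uniqueness / family left in it). With `u_N(i) = (γ/T²)∫₀^∞ Y_i − 1/2`,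
`Y_i(t) = Cov_{Gibbs_T}(p_0², K_t p_i²)` for the `(N+1)`-site equilibrium chain (`K_t = transitionKernel (N+1) T T t`):
the stub holds iff for all admissible parameters and `T > 0` there is `B` with `|u_N(i)| ≤ B` for every `N` and every
`i : Fin (N+1)`. (→): run the stub along a steady family chosen from `pinnedChain_exists_isSteadyState`
(`TwoModeBulk.Sketch.exists_steadyFamily`) at the proved uniqueness `NessUnique_holds`; the quotient at `i` tends to
`u_N(i)` (`tendsto_profileValue`). (←): limits along `𝓝[≠] 0` are unique, so every limit `t` IS `u_N(i)`; `N = 0` sites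
is vacuous. [folklore] -/
theorem stub_profileBound_iff_cutBondBound :
    (∀ ω₂ lam β γ : ℝ, 0 < ω₂ → 0 < lam → 0 < β → 0 < γ → (∀ (N : ℕ) (T_L T_R : ℝ), 0 < T_L → 0 < T_R → ∀ μ ν : MeasureTheory.Measure (Literature.MathematicalPhysics.KineticTheory.HeatConduction.PhaseSpace N), (Literature.MathematicalPhysics.KineticTheory.HeatConduction.pinnedChain ω₂ lam β γ).IsSteadyState N T_L T_R μ → (Literature.MathematicalPhysics.KineticTheory.HeatConduction.pinnedChain ω₂ lam β γ).IsSteadyState N T_L T_R ν → μ = ν) → ∀ μ : (N : ℕ) → ℝ → ℝ → MeasureTheory.Measure (Literature.MathematicalPhysics.KineticTheory.HeatConduction.PhaseSpace N), (∀ (N : ℕ) (T_L T_R : ℝ), 0 < T_L → 0 < T_R → (Literature.MathematicalPhysics.KineticTheory.HeatConduction.pinnedChain ω₂ lam β γ).IsSteadyState N T_L T_R (μ N T_L T_R)) → ∀ T : ℝ, 0 < T → ∃ B : ℝ, ∀ (N : ℕ) (i : Fin N) (t : ℝ), Filter.Tendsto (fun δ : ℝ => ((∫ x, (x.2 i) ^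 2 ∂(μ N (T + δ / 2) (T - δ / 2))) - ∫ x, (x.2 i) ^ 2 ∂(μ N T T)) / δ) (nhdsWithin 0 {(0 : ℝ)}ᶜ) (nhds t) → |t| ≤ B) ↔
    (∀ ω₂ lam β γ : ℝ, 0 < ω₂ → 0 < lam → 0 < β → 0 < γ → ∀ T : ℝ, 0 < T → ∃ B : ℝ, ∀ (N : ℕ) (i : Fin (N + 1)), |γ / T ^ 2 * (∫ t in Set.Ioi (0 : ℝ), ((∫ z, (z.2 0) ^ 2 * (∫ y, (y.2 i) ^ 2 ∂((Literature.MathematicalPhysics.KineticTheory.HeatConduction.pinnedChain ω₂ lam β γ).transitionKernel (N + 1) T T t.toNNReal z)) ∂((Literature.MathematicalPhysics.KineticTheory.HeatConduction.pinnedChain ω₂ lam β γ).gibbsMeasure (N + 1) T)) - (∫ z, (z.2 0) ^ 2 ∂((Literature.MathematicalPhysics.KineticTheory.HeatConduction.pinnedChain ω₂ lam β γ).gibbsMeasure (N + 1) T)) * (∫ z, (∫ y, (y.2 i) ^ 2 ∂((Literature.MathematicalPhysics.KineticTheory.HeatConduction.pinnedChain ω₂ lam β γ).transitionKernel (N + 1)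 T T t.toNNReal z)) ∂((Literature.MathematicalPhysics.KineticTheory.HeatConduction.pinnedChain ω₂ lam β γ).gibbsMeasure (N + 1) T)))) - 1 / 2| ≤ B) := by
  constructor
  · -- (→): the stub along a chosen steady family at the proved uniqueness, with the identified limits
    intro h ω₂ lam β γ hω hl hβ hγ T hT
    have hU : UniqueSteady ω₂ lam β γ :=
      Summit.AtomisticToContinuum.FouriersLaw.Theses.TransferKernelPositivity.NessUnique_holds ω₂ lam β γ hω hl hβ hγ
    obtain ⟨μ, hμ⟩ := exists_steadyFamily hω hl hβ hγ
    obtain ⟨B, hB⟩ := h ω₂ lam β γ hω hl hβ hγ hU μ hμ T hT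
    exact ⟨B, fun N i => hB (N + 1) i _ (tendsto_profileValue hω hl hβ hγ hU hμ hT N i)⟩
  · -- (←): any limit along `𝓝[≠] 0` is the cut-bond value
    intro h ω₂ lam β γ hω hl hβ hγ huniq μ hμ T hT
    have hU : UniqueSteady ω₂ lam β γ := huniq
    have hfam : SteadyFamily ω₂ lam β γ μ := hμ
    obtain ⟨B, hB⟩ := h ω₂ lam β γ hω hl hβ hγ T hT
    refine ⟨B, fun N i t ht => ?_⟩
    cases N with
    | zero => exact i.elim0
    | succ M =>
      rw [tendsto_nhds_unique ht (tendsto_profileValue hω hl hβ hγ hU hfam hT M i)]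
      exact hB M i

end Summit.AtomisticToContinuum.FouriersLaw.Theorems

end
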